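import Literature.MathematicalPhysics.QuantumFieldTheory.Balaban1983to89.B9Thm311PositivityKnitLetter
import Literature.MathematicalPhysics.QuantumFieldTheory.Balaban1983to89.B8TorusShiftLandau

/-!
# `Balaban1983to89.B9B8KnitLetterPeriodic` — JUNCTION J-B, FILE 4a: the junction identities are `N₀`-PERIODIC on `ℤ^{d+1}`, so the consumer's (E1)
# (`Δ′ ∘ Gp = 1` read through (E3)∕(E4)∕(E5) of `B8Thm2TorusLetters.LettersAt`) holds at EVERY point of `ℤ^{d+1}` for periodic arguments

statement-level skeleton of published theorems with citation tags; proofs where landed; nothing here is a claim about the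
Yang–Mills mass gap

T. Bałaban, *Propagators for lattice gauge theories in a background field*, Commun. Math. Phys. **99** (1985) 389–434
[`Balaban1985BackgroundPropagators`, "[B9]"]; T. Bałaban, *Spaces of regular gauge field configurations on a lattice and gauge fixing conditions*,
Commun. Math. Phys. **99** (1985) 75–102 [`Balaban1985RegularSpaces`, "[B8]"]; T. Bałaban, *Averaging operations for lattice gauge theories*, Commun.
Math. Phys. **98** (1985) 17–51 [`Balaban1985Averaging`, "[B7]"].

THE PRINT.  [B8] p. 77: *«we admit the case where some domains Ω_j are equal to T_η»* — the knit reads the torus `T_η` as `P`-PERIODIC data on `ℤᵈ`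
(`B8Thm4TorusAt`, `B8Thm2TorusAt`); the operators (3.19), (3.23), (3.24) of [B9] commute with the translations of the lattice ([B7] (43): the blocks
`B(y)` translate with the lattice; `B8TorusShiftStencils ∕ Averaging ∕ Landau`).

CITATION HEADER (lean-in-tree rule).  Cell `lit-balaban`, sub-row G-B9-LETTERS, junction J-B (lead RULING #3) file 4a of `lit-balaban-p33/JAB-STATEMENTS.md`
v1.1 → seat `lit-balaban-p33` gen 91.  REUSED BY NAME: the knit's translation covariance (`covLap_shiftCfg`, `bgT_shiftCfg`, `QprimeT_shiftCfg`,
`sum_blockSites_add`), J-A (`liftCfg_periodic`, `shiftCfg_liftFun`, `liftFun_descFun`, `boxEquiv_transl_of_mem`), J-B files 2–3 (`QT_torusLam_eq`, `awOp`,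
`cKnit`, `knit_E1_at_box`).

WHAT THIS FILE PROVES (sorry-free; no definitions).
* §1 `Q′_j(U₀)` OF TRANSLATED DATA: `Q′_j(t_{Lʲw}U₀)(t_{Lʲw}f)(y) = (Q′_j(U₀)f)(y + w)` (`QprimeIter_bgT_shiftCfg`, the `QprimeIter` twin of
  `B8TorusShiftAveraging.Rbar_bgT_shiftCfg`).
* §2 PERIODICITY at a member (`N₀ = L^k·L·M_h·P′ = Lʲ·q_j` for `j ≤ k`): for the periodic lift `U₀ = liftCfg U` and an `N₀`-periodic `f`, `covLap η U₀ f`,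
  `Q′_j(U₀)f` (period `q_j` on the `j`-lattice) and `QT L n (torusLam n) U₀ ν` (for a level-`n` multiplier of period `q_n`) are periodic.
* §3 ★ A PERIODIC FUNCTION IS READ OFF THE BOX: `F(x) = F(chart(0 + x))` (`periodic_eq_at_chart`), hence ★★★ `knit_E1`: the (E1) identity of
  `B9Thm311PositivityKnitLetter.knit_E1_at_box` at EVERY `x ∈ ℤ^{d+1}` — `covLap η U₀ g x + QT L n (torusLam n) U₀ (awOp (cKnit η) (j ↦ Q′_j(U₀) g)) x
  = liftFun (X ∘ chart) x`, `g = liftFun ((GpKnitY η U X) ∘ chart)`.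

HONEST SCOPE.  As in file 3: `G`-valued knit legs (`hpar`) is a hypothesis (file 4b discharges it on the (52)-small class); constant-level members; `𝔸 = M_N(ℂ)`
for (E1); no estimate of [B8]∕[B9] is proved or asserted; count-neutral; nothing continuum, nothing about OS axioms or the mass gap.  No `sorry`, no `axiom`,
no `instance`, no `notation`.  Seat `lit-balaban-p33` gen 91, 2026-08-28.
-/

noncomputable section

namespace Literature.MathematicalPhysics.QuantumFieldTheory.Balaban1983to89.B9B8KnitLetterPeriodic

open B7Prop1Explicit renaming Site → LSite
open B7Prop1Explicit (e)
open Literature.MathematicalPhysics.QuantumLattice (blockSites blockBase)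
open B7Eq78Linearization (conjR Qprime Qprime_apply QprimeIter QprimeIter_succ zdBlocking)
open B8Eq119TwistedAxial (bgT)
open B8Eq138LandauZd (covLap QprimeT QT)
open B8Thm4TorusAt (torusLam)
open B12Ineq417Flat (shiftCfg shiftCfg_apply)
open B8TorusShiftStencils (covLap_shiftCfg)
open B8TorusShiftAveraging (bgT_shiftCfg sum_blockSites_add)
open B8TorusShiftLandau (QprimeT_shiftCfg)
open B10Eq27TorusAxialLog (transl)
open B6MultiLevelBoxOperator (N0)
open B6GlobalChartV1 (PV boxEquiv)
open B6KLevelCensusIndexV1 (KIdx)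
open B6Prop22KLevelTorusCensus (KTIdx)
open B9B8CarrierDictionary (liftFun liftFun_apply descFun descFun_apply liftCfg liftCfg_periodic shiftCfg_liftFun liftFun_descFun)
open B9B8AveragingJunction (parKnitY boxEquiv_transl_of_mem liftFun_chart_apply)
open B9B8DeltaPrimeJunction (awOp awOp_apply cKnit QT_torusLam_eq)
open B9Thm311PositivityKnitLetter (GpKnitY knit_E1_at_box)
open Node00

variable {d ℓ : ℕ} {hd : 1 ≤ d + 1} {hL : Odd (ℓ + 1) ∧ 1 < ℓ + 1} {b₀ b₁ : ℝ}

/-! ## §1 `Q′_j(U₀)` of translated data -/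

section Shift

variable {D : ℕ} {𝔸 : Type*} [NormedRing 𝔸] [NormedAlgebra ℂ 𝔸] [CompleteSpace 𝔸]

omit [CompleteSpace 𝔸] in
/-- the one-step covariant average over `B(y + w)` is the average over `B(y)` of the data translated by `Lw` (uniform weights).
[cite: Balaban1985BackgroundPropagators, (3.18)–(3.19) p.393; Balaban1985Averaging, (43) p.24] -/
theorem Qprime_blockSites_shift (L : ℕ) (y w : LSite D) (c : ℝ) (T : LSite D → 𝔸ˣ) (v : LSite D → 𝔸) :
    Qprime (blockSites L y) (fun _ => c) (fun x => T (x + (L : ℤ) • w)) (fun x => v (x + (L : ℤ) • w)) = Qprime (blockSites L (y + w)) (fun _ => c) T v := by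
  rw [Qprime_apply, Qprime_apply, sum_blockSites_add]

/-- ★ **`Q′_j(U₀)` OF TRANSLATED DATA**: translating the background and the site function on the fine lattice by `Lʲw` translates `Q′_j(U₀)f` on the
`j`-lattice by `w`. [cite: Balaban1985BackgroundPropagators, (3.19) p.393; Balaban1985Averaging, (43) p.24, (79)–(80) p.30] -/
theorem QprimeIter_bgT_shiftCfg (L : ℕ) (U₀ : LSite D → Fin D → 𝔸ˣ) :
    ∀ (j : ℕ) (w : LSite D) (f : LSite D → 𝔸) (y : LSite D),
      QprimeIter (zdBlocking D L) (bgT L (shiftCfg (((L : ℤ) ^ j) • w) U₀)) j (shiftCfg (((L : ℤ) ^ j) • w) f) y =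
        QprimeIter (zdBlocking D L) (bgT L U₀) j f (y + w)
  | 0, w, f, y => by simp [QprimeIter, shiftCfg_apply]
  | j + 1, w, f, y => by
      have hv : ((L : ℤ) ^ (j + 1)) • w = ((L : ℤ) ^ j) • ((L : ℤ) • w) := by rw [pow_succ, mul_smul]
      rw [hv, QprimeIter_succ, QprimeIter_succ]
      have IHf : QprimeIter (zdBlocking D L) (bgT L (shiftCfg (((L : ℤ) ^ j) • ((L : ℤ) • w)) U₀)) j (shiftCfg (((L : ℤ) ^ j) • ((L : ℤ) • w)) f)
          = fun x => QprimeIter (zdBlocking D L) (bgT L U₀) j f (x + (L : ℤ) • w) :=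
        funext fun y' => QprimeIter_bgT_shiftCfg L U₀ j ((L : ℤ) • w) f y'
      have hT : bgT L (shiftCfg (((L : ℤ) ^ j) • ((L : ℤ) • w)) U₀) j y = fun x => bgT L U₀ j (y + w) (x + (L : ℤ) • w) :=
        funext fun x => bgT_shiftCfg L U₀ j w y x
      rw [IHf, hT]
      exact Qprime_blockSites_shift L y w _ (bgT L U₀ j (y + w)) (QprimeIter (zdBlocking D L) (bgT L U₀) j f)

end Shift

/-! ## §2 Periodicity of the knit's letters at a member's periodic lift -/

section Periodic

variable {𝔸 : Type} [NormedRing 𝔸] [NormedAlgebra ℂ 𝔸] [CompleteSpace 𝔸]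
variable (i : KIdx d ℓ hd hL b₀ b₁)

/-- the period of the member's torus in lattice units, `N₀` (the same in every direction, `KIdx.hN`). [cite: Balaban1984PropagatorsII, (2.1) p.224, dictionary] -/
theorem period_eq_N0 (μ : Fin (d + 1)) : (PV d ℓ i.m i.K hd hL).sitesPerDir 0 = N0 ℓ i.Mh i.k i.P' μ := (i.hN μ).symm

/-- **the period of the level-`j` lattice**: `q_j = L^{k−j}·L·M_h·P′_μ` (`N₀ = Lʲ·q_j`, `j ≤ k`). [cite: Balaban1984PropagatorsII, (2.1) p.224, dictionary] -/
def qLev (j : ℕ) (μ : Fin (d + 1)) : ℕ := (ℓ + 1) ^ (i.k - j) * ((ℓ + 1) * (i.Mh * i.P' μ))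

/-- `N₀ = Lʲ · q_j` for `j ≤ k`. [cite: Balaban1984PropagatorsII, (2.1) p.224, dictionary] -/
theorem period_eq_pow_mul {j : ℕ} (hj : j ≤ i.k) (μ : Fin (d + 1)) : (PV d ℓ i.m i.K hd hL).sitesPerDir 0 = (ℓ + 1) ^ j * qLev i j μ := by
  rw [qLev, period_eq_N0 i μ, ← mul_assoc, ← pow_add, Nat.add_sub_cancel' hj]

/-- the period vector `N₀e_μ` is `Lʲ` times the level-`j` period vector `q_j e_μ`. [cite: Balaban1984PropagatorsII, (2.1) p.224, dictionary] -/
theorem period_smul_eq {j : ℕ} (hj : j ≤ i.k) (μ : Fin (d + 1)) :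
    (((PV d ℓ i.m i.K hd hL).sitesPerDir 0 : ℕ) : ℤ) • (e μ : LSite (d + 1)) = (((ℓ + 1 : ℕ) : ℤ) ^ j) • (((qLev i j μ : ℕ) : ℤ) • (e μ : LSite (d + 1))) := by
  rw [smul_smul, period_eq_pow_mul i hj μ]
  push_cast
  rfl

/-- ★ the knit's covariant Laplacian of periodic data at the periodic lift is periodic. [cite: Balaban1985BackgroundPropagators, (3.23) p.394; Balaban1985RegularSpaces, p.77 («Ω_j = T_η»)] -/
theorem covLap_periodic (η : ℝ) (U : CfgY 𝔸 i) {f : LSite (d + 1) → 𝔸}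
    (hf : ∀ μ, shiftCfg ((((PV d ℓ i.m i.K hd hL).sitesPerDir 0 : ℕ) : ℤ) • e μ) f = f) (x : LSite (d + 1)) (μ : Fin (d + 1)) :
    covLap η (liftCfg U) f (x + (((PV d ℓ i.m i.K hd hL).sitesPerDir 0 : ℕ) : ℤ) • e μ) = covLap η (liftCfg U) f x := by
  rw [← covLap_shiftCfg, liftCfg_periodic, hf]

/-- ★ `Q′_j(U₀)f` of periodic data is periodic on the `j`-lattice with period `q_j = N₀/Lʲ` (`j ≤ k`). [cite: Balaban1985BackgroundPropagators, (3.19) p.393; Balaban1985RegularSpaces, p.77] -/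
theorem QprimeIter_periodic (U : CfgY 𝔸 i) {f : LSite (d + 1) → 𝔸}
    (hf : ∀ μ, shiftCfg ((((PV d ℓ i.m i.K hd hL).sitesPerDir 0 : ℕ) : ℤ) • e μ) f = f) {j : ℕ} (hj : j ≤ i.k) (y : LSite (d + 1)) (μ : Fin (d + 1)) :
    QprimeIter (zdBlocking (d + 1) (ℓ + 1)) (bgT (ℓ + 1) (liftCfg U)) j f (y + ((qLev i j μ : ℕ) : ℤ) • e μ)
      = QprimeIter (zdBlocking (d + 1) (ℓ + 1)) (bgT (ℓ + 1) (liftCfg U)) j f y := by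
  rw [← QprimeIter_bgT_shiftCfg (ℓ + 1) (liftCfg U) j _ f y, ← period_smul_eq i hj μ, liftCfg_periodic, hf]

/-- ★ the single-level transpose `QT L n (torusLam n) U₀ ν` of a level-`n` multiplier of period `q_n` is periodic (`n ≤ k`).
[cite: Balaban1985BackgroundPropagators, (3.24) p.394; Balaban1985RegularSpaces, (1.29) p.81, p.77] -/
theorem QT_periodic (U : CfgY 𝔸 i) {n : ℕ} (hn : n ≤ i.k) {ν : ℕ → LSite (d + 1) → 𝔸} (μ : Fin (d + 1))
    (hν : shiftCfg (((qLev i n μ : ℕ) : ℤ) • e μ) (ν n) = ν n) (x : LSite (d + 1)) :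
    QT (ℓ + 1) n (torusLam n) (liftCfg U) ν (x + (((PV d ℓ i.m i.K hd hL).sitesPerDir 0 : ℕ) : ℤ) • e μ)
      = QT (ℓ + 1) n (torusLam n) (liftCfg U) ν x := by
  have hL1 : 1 ≤ ℓ + 1 := Nat.succ_pos ℓ
  rw [QT_torusLam_eq, QT_torusLam_eq, period_smul_eq i hn μ, ← QprimeT_shiftCfg hL1 (liftCfg U) n _ (ν n) x, ← period_smul_eq i hn μ,
    liftCfg_periodic, hν]

/-- the weighted levels of `Q′_·(U₀)g` for periodic `g` have the level-`n` component of period `q_n`. [cite: Balaban1985BackgroundPropagators, (3.24) p.394, bookkeeping] -/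
theorem awOp_QprimeIter_periodic (U : CfgY 𝔸 i) (c : ℕ → ℝ) {g : LSite (d + 1) → 𝔸}
    (hg : ∀ μ, shiftCfg ((((PV d ℓ i.m i.K hd hL).sitesPerDir 0 : ℕ) : ℤ) • e μ) g = g) {n : ℕ} (hn : n ≤ i.k) (μ : Fin (d + 1)) :
    shiftCfg (((qLev i n μ : ℕ) : ℤ) • e μ) ((awOp c fun j => QprimeIter (zdBlocking (d + 1) (ℓ + 1)) (bgT (ℓ + 1) (liftCfg U)) j g) n)
      = (awOp c fun j => QprimeIter (zdBlocking (d + 1) (ℓ + 1)) (bgT (ℓ + 1) (liftCfg U)) j g) n := by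
  funext y
  rw [shiftCfg_apply, awOp_apply, awOp_apply, QprimeIter_periodic i U hg hn]

end Periodic

/-! ## §3 A periodic function is read off the fundamental box; (E1) everywhere -/

section Everywhere

variable (i : KIdx d ℓ hd hL b₀ b₁)

/-- ★ **A PERIODIC FUNCTION ON `ℤ^{d+1}` IS READ OFF THE BOX**: `F(x) = F(chart(0 + x))` — `F` factors through the torus (J-A's `liftFun_descFun`) and the
chart of `0 + x` is a box point with the same torus image. [cite: Balaban1985RegularSpaces, p.77 («Ω_j = T_η»); Balaban1984PropagatorsII, (2.1) p.224, dictionary] -/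
theorem periodic_eq_at_chart {β : Type*} {F : LSite (d + 1) → β}
    (hF : ∀ (x : LSite (d + 1)) (μ : Fin (d + 1)), F (x + (((PV d ℓ i.m i.K hd hL).sitesPerDir 0 : ℕ) : ℤ) • e μ) = F x) (x : LSite (d + 1)) :
    F x = F (boxEquiv i.hN (transl (0 : Site (PV d ℓ i.m i.K hd hL) 0) x)).1 := by
  set z : SiteY i := boxEquiv i.hN (transl (0 : Site (PV d ℓ i.m i.K hd hL) 0) x) with hz
  have hzx : transl (0 : Site (PV d ℓ i.m i.K hd hL) 0) z.1 = transl 0 x :=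
    (boxEquiv i.hN).injective (by rw [boxEquiv_transl_of_mem i z.2, hz])
  have hlift : liftFun (P := PV d ℓ i.m i.K hd hL) (descFun F) = F := liftFun_descFun (P := PV d ℓ i.m i.K hd hL) hF
  calc F x = liftFun (P := PV d ℓ i.m i.K hd hL) (descFun F) x := by rw [hlift]
    _ = descFun (P := PV d ℓ i.m i.K hd hL) F (transl 0 z.1) := by rw [liftFun_apply, hzx]
    _ = liftFun (P := PV d ℓ i.m i.K hd hL) (descFun F) z.1 := rfl
    _ = F z.1 := by rw [hlift]

open scoped Matrix Matrix.Norms.L2Operator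

variable {N : ℕ} {G : Subgroup (Matrix (Fin N) (Fin N) ℂ)ˣ}

/-- a constant level is at most `k`. [cite: Balaban1984PropagatorsII, (2.3)–(2.4) p.224, bookkeeping] -/
theorem constLev_le {n : ℕ} (hlev : ∀ z : SiteY i, levY i z = n) : n ≤ i.k := by
  rw [← hlev (toKT i).origin]; exact (toKT i).D.lev_le _

/-- ★★★ **THE CONSUMER's (E1) AT EVERY POINT OF `ℤ^{d+1}`.**  On a constant-level member, for `G ≤ U(N)`, a `G`-valued `U` with `G`-valued knit legs,
`η ≠ 0` and every `X` on the box chart: with `g = liftFun ((GpKnitY η U X) ∘ chart)` and `U₀ = liftCfg U`, for ALL `x`,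
`covLap η U₀ g x + QT L n (torusLam n) U₀ (awOp (cKnit η) (j ↦ Q′_j(U₀) g)) x = liftFun (X ∘ chart) x` — `Δ′ ∘ Gp = 1` on the periodic lift of
every box-chart function, read through (E3)∕(E4)∕(E5) of `B8Thm2TorusLetters.LettersAt`. [cite: Balaban1985BackgroundPropagators, (3.24)–(3.25) pp.394–395, Thm 3.11 p.416; Balaban1985RegularSpaces, (1.95) p.91, (1.29) p.81, p.77 («Ω_j = T_η»)] -/
theorem knit_E1 {n : ℕ} (hlev : ∀ z : SiteY i, levY i z = n) (hG : G ≤ B7Prop2Explicit.unitaryUnits (Matrix (Fin N) (Fin N) ℂ))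
    {U : CfgY (Matrix (Fin N) (Fin N) ℂ) i} (hU : ∀ μ x, U μ x ∈ G) (hpar : ∀ z w : SiteY i, parKnitY i U z w ∈ G) {η : ℝ} (hη : η ≠ 0)
    (X : SiteY i → Matrix (Fin N) (Fin N) ℂ) (x : LSite (d + 1)) :
    covLap η (liftCfg U) (liftFun ((GpKnitY i η U X) ∘ ⇑(boxEquiv i.hN))) x
        + QT (ℓ + 1) n (torusLam n) (liftCfg U)
            (awOp (cKnit (d := d) (ℓ := ℓ) η) fun j =>
              QprimeIter (zdBlocking (d + 1) (ℓ + 1)) (bgT (ℓ + 1) (liftCfg U)) j (liftFun ((GpKnitY i η U X) ∘ ⇑(boxEquiv i.hN)))) x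
      = liftFun (X ∘ ⇑(boxEquiv i.hN)) x := by
  have hn : n ≤ i.k := constLev_le i hlev
  have hg : ∀ μ, shiftCfg ((((PV d ℓ i.m i.K hd hL).sitesPerDir 0 : ℕ) : ℤ) • e μ) (liftFun ((GpKnitY i η U X) ∘ ⇑(boxEquiv i.hN)))
      = liftFun ((GpKnitY i η U X) ∘ ⇑(boxEquiv i.hN)) := fun μ => shiftCfg_liftFun _ μ
  let F : LSite (d + 1) → Matrix (Fin N) (Fin N) ℂ := fun y =>
    covLap η (liftCfg U) (liftFun ((GpKnitY i η U X) ∘ ⇑(boxEquiv i.hN))) y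
      + QT (ℓ + 1) n (torusLam n) (liftCfg U)
          (awOp (cKnit (d := d) (ℓ := ℓ) η) fun j =>
            QprimeIter (zdBlocking (d + 1) (ℓ + 1)) (bgT (ℓ + 1) (liftCfg U)) j (liftFun ((GpKnitY i η U X) ∘ ⇑(boxEquiv i.hN)))) y
  have hper : ∀ (y : LSite (d + 1)) (μ : Fin (d + 1)), F (y + (((PV d ℓ i.m i.K hd hL).sitesPerDir 0 : ℕ) : ℤ) • e μ) = F y := by
    intro y μ
    simp only [F]
    rw [covLap_periodic i η U hg, QT_periodic i U hn μ (awOp_QprimeIter_periodic i U _ hg hn μ)]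
  exact (periodic_eq_at_chart i (F := F) hper x).trans (knit_E1_at_box i hlev hG hU hpar hη X _)

end Everywhere

end Literature.MathematicalPhysics.QuantumFieldTheory.Balaban1983to89.B9B8KnitLetterPeriodic

end
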